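import Summits.RiemannHypothesis.RiemannHypothesis.Theorems.WeilFormatCMeanSquareGram
import Summits.RiemannHypothesis.RiemannHypothesis.Theorems.WeilFormatCTailJointGram
import HarnessLib

/-!
# Format C, L-C3b joint tail (design "TJ"): the structured part, summed — `Σ_m ((F_m/π)P_A(m) + P_B(m))²`

Route context: Fourier–Galerkin / Schur-complement certificates of Weil positivity on a window ("format C";
cell memo `run/shared/lean/pub/rh-explicit/rh-explicit-weil-10/FORMATC-DESIGN.md` §9.9.7; supporting
stmt-RiemannHypothesis-0098; seat rh-explicit-weil-10; lead ruling R8-15 (C)).  `WeilFormatC.sum_sq_joint_le`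
instantiated with the tree's mode function `F_m = ½·Im ψ(¼ + iω_m/2) + Σ_k Λ_k k^{-1/2} sin(ω_m log k) − T_m`
(`= π/4 + δ_m + S_m`, `|δ_m| ≤ a(1+E)/(πB₃)` for `m ≥ B₃` by `abs_smoothMode_sub_le`), the centred mean square
`modeSqCentered_le`, the pair-oscillation and prime-sum moments (`abs_sum_Ico_oscPairs_div_pow_le`,
`abs_sum_Ico_primeSum_div_pow_le`; resonance data `s₁, s₋, s₊`, value `0` = crude) and the two explicit zeta-Gram
majorants (`sum_Ico_sq_add_sum_div_pow_le` for `P_A/4 + P_B`, `sum_Ico_sq_sum_div_pow_le` for `P_A`): for ARBITRARY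
exponent families `e^A, e^B ≥ 1`, positive weights `μ, ν` and coefficients `α^A, α^B`,

* `tailJJ_structured_le` — `Σ_{m∈Ico B₃ N} ((F_m/π)·Σ_j α^A_j/m^{e^A_j} + Σ_r α^B_r/m^{e^B_r})² ≤` the explicit,
  `N`-uniform joint bound (both sectors use it: even `e^A = 2j+1, e^B = 2r+2`; odd `2j+2, 2r+1` at tail start `B₃+1`).

Standard axioms; no definitions; no RH claim.
-/

set_option autoImplicit false
-- `Summit.RiemannHypothesis.RiemannHypothesis.…` is the layout-mandated namespace (summit = problem name).
set_option linter.dupNamespace false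

noncomputable section

open Complex Finset Matrix
open scoped Real BigOperators ArithmeticFunction.vonMangoldt

namespace Summit.RiemannHypothesis.RiemannHypothesis.Theorems.WeilFormatC

open Literature.NumberTheory.LFunctions Literature.NumberTheory.LFunctions.Yoshida1992
open Literature.Analysis.SpecialFunctions

variable {a : ℝ}

/-! ## The structured sum -/

section Structured

/-- **The structured part of the joint (`TJ`) tail, summed over the tail modes** — see the module docstring.
The right-hand side is `(1 + c/π)·Ẑ_J(α^A/4, α^B) + (c/π + c̄₂/π²)·Ẑ_A(α^A) + π⁻²·(pair Gershgorin)
+ (2π)⁻¹·(single Gershgorin on A×A) + π⁻¹·(single Gershgorin on A×B)` with `c = a(1+E)/(πB₃)`. -/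
theorem tailJJ_structured_le (ha : 0 < a) {B₃ : ℕ} (hB₃ : 2 ≤ B₃) {DA DB : ℕ} (eA : Fin DA → ℕ) (eB : Fin DB → ℕ)
    (heA : ∀ j, 1 ≤ eA j) (heB : ∀ r', 1 ≤ eB r') (mu : Fin DA → ℝ) (nu : Fin DB → ℝ) (hmu : ∀ j, 0 < mu j)
    (hnu : ∀ r', 0 < nu r')
    (s₁ : ℕ → ℝ) (sm sp : ℕ → ℕ → ℝ)
    (hs₁ : ∀ k ∈ weilPrimeIndex a, IsPrimePow k → 0 ≤ s₁ k ∧ s₁ k ≤ |Real.sin (π * Real.log k / a / 2)|)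
    (hsm : ∀ k ∈ weilPrimeIndex a, ∀ k' ∈ weilPrimeIndex a, IsPrimePow k → IsPrimePow k' → k ≠ k' →
      0 ≤ sm k k' ∧ sm k k' ≤ |Real.sin ((π * Real.log k / a - π * Real.log k' / a) / 2)|)
    (hsp : ∀ k ∈ weilPrimeIndex a, ∀ k' ∈ weilPrimeIndex a, IsPrimePow k → IsPrimePow k' →
      0 ≤ sp k k' ∧ sp k k' ≤ |Real.sin ((π * Real.log k / a + π * Real.log k' / a) / 2)|)
    (N : ℕ) (αA : Fin DA → ℝ) (αB : Fin DB → ℝ) :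
    ∑ m ∈ Finset.Ico B₃ N, (((Complex.digamma (1 / 4 + ((freq a m : ℝ) : ℂ) / 2 * I)).im / 2 + (∑ k ∈ weilPrimeIndex a, (Λ k : ℝ) / Real.sqrt k * Real.sin (freq a m * Real.log k)) - archExpSumSin a m) / π
        * (∑ j, αA j / (m : ℝ) ^ eA j) + ∑ r', αB r' / (m : ℝ) ^ eB r') ^ 2
      ≤ ((1 + (a * (1 + weilArchDensity (2 * a)) / (π * B₃)) / π) * ((((∑ j, ∑ j', αA j / 4 * (αA j' / 4) * ((1 / ((eA j + eA j' - 1 : ℕ) * (((B₃ - 1 : ℕ) : ℝ)) ^ (eA j + eA j' - 1)) + 1 / ((eA j + eA j' - 1 : ℕ) * (B₃ : ℝ) ^ (eA j + eA j' - 1))) / 2))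
            + ∑ r', ∑ j, αB r' * (αA j / 4) * ((1 / ((eB r' + eA j - 1 : ℕ) * (((B₃ - 1 : ℕ) : ℝ)) ^ (eB r' + eA j - 1)) + 1 / ((eB r' + eA j - 1 : ℕ) * (B₃ : ℝ) ^ (eB r' + eA j - 1))) / 2))
          + ((∑ j, ∑ r', αA j / 4 * αB r' * ((1 / ((eA j + eB r' - 1 : ℕ) * (((B₃ - 1 : ℕ) : ℝ)) ^ (eA j + eB r' - 1)) + 1 / ((eA j + eB r' - 1 : ℕ) * (B₃ : ℝ) ^ (eA j + eB r' - 1))) / 2))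
            + ∑ r', ∑ r'', αB r' * αB r'' * ((1 / ((eB r' + eB r'' - 1 : ℕ) * (((B₃ - 1 : ℕ) : ℝ)) ^ (eB r' + eB r'' - 1)) + 1 / ((eB r' + eB r'' - 1 : ℕ) * (B₃ : ℝ) ^ (eB r' + eB r'' - 1))) / 2)))
        + ((((∑ j, (αA j / 4) ^ 2 * ∑ j', ((1 / ((eA j + eA j' - 1 : ℕ) * (((B₃ - 1 : ℕ) : ℝ)) ^ (eA j + eA j' - 1)) - 1 / ((eA j + eA j' - 1 : ℕ) * (B₃ : ℝ) ^ (eA j + eA j' - 1))) / 2) * mu j' / mu j)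
            + ∑ r', αB r' ^ 2 * ∑ j, ((1 / ((eB r' + eA j - 1 : ℕ) * (((B₃ - 1 : ℕ) : ℝ)) ^ (eB r' + eA j - 1)) - 1 / ((eB r' + eA j - 1 : ℕ) * (B₃ : ℝ) ^ (eB r' + eA j - 1))) / 2) * mu j / nu r')
          + ((∑ j, (αA j / 4) ^ 2 * ∑ r', ((1 / ((eA j + eB r' - 1 : ℕ) * (((B₃ - 1 : ℕ) : ℝ)) ^ (eA j + eB r' - 1)) - 1 / ((eA j + eB r' - 1 : ℕ) * (B₃ : ℝ) ^ (eA j + eB r' - 1))) / 2) * nu r' / mu j)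
            + ∑ r', αB r' ^ 2 * ∑ r'', ((1 / ((eB r' + eB r'' - 1 : ℕ) * (((B₃ - 1 : ℕ) : ℝ)) ^ (eB r' + eB r'' - 1)) - 1 / ((eB r' + eB r'' - 1 : ℕ) * (B₃ : ℝ) ^ (eB r' + eB r'' - 1))) / 2) * nu r'' / nu r'))))
        + ((a * (1 + weilArchDensity (2 * a)) / (π * B₃)) / π + ((a * (1 + weilArchDensity (2 * a)) / (π * B₃)) ^ 2 + (∑ k ∈ weilPrimeIndex a, ((Λ k : ℝ) / Real.sqrt k) ^ 2) / 2 + 2 * (a * (1 + weilArchDensity (2 * a)) / (π * B₃)) * (∑ k ∈ weilPrimeIndex a, (Λ k : ℝ) / Real.sqrt k) + ((∑ k ∈ weilPrimeIndex a, ∑ k' ∈ (weilPrimeIndex a).erase k, if sm k k' = 0 then (Λ k : ℝ) / Real.sqrt k * ((Λ k' : ℝ) / Real.sqrt k') else 0) / 2 + (∑ k ∈ weilPrimeIndex a, ∑ k' ∈ weilPrimeIndex a, if sp k k' = 0 then (Λ k : ℝ) / Real.sqrt k * ((Λ k' : ℝ) / Real.sqrt k') else 0) / 2)) / π ^ 2)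 * ((∑ j, ∑ j', αA j * αA j' * ((1 / ((eA j + eA j' - 1 : ℕ) * (((B₃ - 1 : ℕ) : ℝ)) ^ (eA j + eA j' - 1)) + 1 / ((eA j + eA j' - 1 : ℕ) * (B₃ : ℝ) ^ (eA j + eA j' - 1))) / 2))
          + ∑ j, αA j ^ 2 * ∑ j', ((1 / ((eA j + eA j' - 1 : ℕ) * (((B₃ - 1 : ℕ) : ℝ)) ^ (eA j + eA j' - 1)) - 1 / ((eA j + eA j' - 1 : ℕ) * (B₃ : ℝ) ^ (eA j + eA j' - 1))) / 2) * mu j' / mu j)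
        + (1 / π ^ 2) * ∑ j, αA j ^ 2 * ∑ j', ((∑ k ∈ weilPrimeIndex a, ∑ k' ∈ (weilPrimeIndex a).erase k, (Λ k : ℝ) / Real.sqrt k * ((Λ k' : ℝ) / Real.sqrt k') / sm k k') / 2 + (∑ k ∈ weilPrimeIndex a, ∑ k' ∈ weilPrimeIndex a, (Λ k : ℝ) / Real.sqrt k * ((Λ k' : ℝ) / Real.sqrt k') / sp k k') / 2) / (B₃ : ℝ) ^ (eA j + eA j') * mu j' / mu j
        + (1 / (2 * π)) * ∑ j, αA j ^ 2 * ∑ j', ((∑ k ∈ weilPrimeIndex a, (Λ k : ℝ) / Real.sqrt k / s₁ k) / (B₃ : ℝ) ^ (eA j + eA j') + (∑ k ∈ weilPrimeIndex a, if s₁ k = 0 then (Λ k : ℝ) / Real.sqrt k else 0) * (1 / ((eA j + eA j' - 1 : ℕ) * (((B₃ - 1 : ℕ) : ℝ)) ^ (eA j + eA j' - 1)))) * mu j' / mu j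
        + (1 / π) * ((∑ j, αA j ^ 2 * ∑ r', ((∑ k ∈ weilPrimeIndex a, (Λ k : ℝ) / Real.sqrt k / s₁ k) / (B₃ : ℝ) ^ (eA j + eB r') + (∑ k ∈ weilPrimeIndex a, if s₁ k = 0 then (Λ k : ℝ) / Real.sqrt k else 0) * (1 / ((eA j + eB r' - 1 : ℕ) * (((B₃ - 1 : ℕ) : ℝ)) ^ (eA j + eB r' - 1)))) * nu r' / mu j)
          + ∑ r', αB r' ^ 2 * ∑ j, ((∑ k ∈ weilPrimeIndex a, (Λ k : ℝ) / Real.sqrt k / s₁ k) / (B₃ : ℝ) ^ (eA j + eB r') + (∑ k ∈ weilPrimeIndex a, if s₁ k = 0 then (Λ k : ℝ) / Real.sqrt k else 0) * (1 / ((eA j + eB r' - 1 : ℕ) * (((B₃ - 1 : ℕ) : ℝ)) ^ (eA j + eB r' - 1)))) * mu j / nu r')) := by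
  set T := Finset.Ico B₃ N with hT
  have hB₃1 : 1 ≤ B₃ := by omega
  have hB30 : (0 : ℝ) < B₃ := by exact_mod_cast (by omega : 0 < B₃)
  have hE0 : 0 < weilArchDensity (2 * a) := weilArchDensity_pos (by positivity)
  set δm : ℕ → ℝ := fun n ↦ (Complex.digamma (1 / 4 + ((freq a n : ℝ) : ℂ) / 2 * I)).im / 2 - archExpSumSin a n - π / 4
    with hδm
  set Sm : ℕ → ℝ := fun n ↦ ∑ k ∈ weilPrimeIndex a, (Λ k : ℝ) / Real.sqrt k * Real.sin ((n : ℝ) * (π * Real.log k / a))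
    with hSm
  have hstruct : ∑ m ∈ T, (((Complex.digamma (1 / 4 + ((freq a m : ℝ) : ℂ) / 2 * I)).im / 2 + (∑ k ∈ weilPrimeIndex a, (Λ k : ℝ) / Real.sqrt k * Real.sin (freq a m * Real.log k)) - archExpSumSin a m) / π
        * (∑ j, αA j / (m : ℝ) ^ eA j) + ∑ r', αB r' / (m : ℝ) ^ eB r') ^ 2
      = ∑ m ∈ T, ((π / 4 + δm m + Sm m) / π * (∑ j, αA j / (m : ℝ) ^ eA j) + ∑ r', αB r' / (m : ℝ) ^ eB r') ^ 2 := by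
    refine Finset.sum_congr rfl fun m _ ↦ ?_
    simp only [hδm, hSm, freq_mul_log_eq]
    ring
  -- the data in the generic ("zero weight or sine bound") form
  have hw : ∀ k, 0 ≤ (Λ k : ℝ) / Real.sqrt k :=
    fun k ↦ div_nonneg ArithmeticFunction.vonMangoldt_nonneg (Real.sqrt_nonneg _)
  have hwz : ∀ k, ¬ IsPrimePow k → (Λ k : ℝ) / Real.sqrt k = 0 := fun k hk ↦ by
    rw [ArithmeticFunction.vonMangoldt_eq_zero_iff.mpr hk, zero_div]
  have hs₁' : ∀ k ∈ weilPrimeIndex a, (Λ k : ℝ) / Real.sqrt k = 0 ∨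
      (0 ≤ s₁ k ∧ s₁ k ≤ |Real.sin (π * Real.log k / a / 2)|) := fun k hk ↦ by
    by_cases hkp : IsPrimePow k
    · exact Or.inr (hs₁ k hk hkp)
    · exact Or.inl (hwz k hkp)
  have hsm' : ∀ k ∈ weilPrimeIndex a, ∀ k' ∈ weilPrimeIndex a, k ≠ k' →
      (Λ k : ℝ) / Real.sqrt k * ((Λ k' : ℝ) / Real.sqrt k') = 0 ∨
        (0 ≤ sm k k' ∧ sm k k' ≤ |Real.sin ((π * Real.log k / a - π * Real.log k' / a) / 2)|) :=
    fun k hk k' hk' hne ↦ by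
      by_cases hkp : IsPrimePow k ∧ IsPrimePow k'
      · exact Or.inr (hsm k hk k' hk' hkp.1 hkp.2 hne)
      · refine Or.inl ?_
        rcases not_and_or.mp hkp with h | h
        · rw [hwz k h, zero_mul]
        · rw [hwz k' h, mul_zero]
  have hsp' : ∀ k ∈ weilPrimeIndex a, ∀ k' ∈ weilPrimeIndex a,
      (Λ k : ℝ) / Real.sqrt k * ((Λ k' : ℝ) / Real.sqrt k') = 0 ∨
        (0 ≤ sp k k' ∧ sp k k' ≤ |Real.sin ((π * Real.log k / a + π * Real.log k' / a) / 2)|) :=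
    fun k hk k' hk' ↦ by
      by_cases hkp : IsPrimePow k ∧ IsPrimePow k'
      · exact Or.inr (hsp k hk k' hk' hkp.1 hkp.2)
      · refine Or.inl ?_
        rcases not_and_or.mp hkp with h | h
        · rw [hwz k h, zero_mul]
        · rw [hwz k' h, mul_zero]
  -- the smooth part and the centred mean square per mode
  have hc : 0 ≤ a * (1 + weilArchDensity (2 * a)) / (π * B₃) := by positivity
  have hδ : ∀ m ∈ T, |δm m| ≤ a * (1 + weilArchDensity (2 * a)) / (π * B₃) := by
    intro m hm
    have hmB : B₃ ≤ m := (Finset.mem_Ico.mp hm).1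
    have hm1 : 1 ≤ m := le_trans hB₃1 hmB
    have hBm : (B₃ : ℝ) ≤ m := by exact_mod_cast hmB
    exact (abs_smoothMode_sub_le ha hm1).trans
      (div_le_div_of_nonneg_left (by positivity) (by positivity) (mul_le_mul_of_nonneg_left hBm Real.pi_pos.le))
  have hW1 := Finset.sum_nonneg fun k (_ : k ∈ weilPrimeIndex a) ↦ hw k
  have hκ2 : 0 ≤ (∑ k ∈ weilPrimeIndex a, ∑ k' ∈ (weilPrimeIndex a).erase k, if sm k k' = 0 then (Λ k : ℝ) / Real.sqrt k * ((Λ k' : ℝ) / Real.sqrt k') else 0) / 2 + (∑ k ∈ weilPrimeIndex a, ∑ k' ∈ weilPrimeIndex a, if sp k k' = 0 then (Λ k : ℝ) / Real.sqrt k * ((Λ k' : ℝ) / Real.sqrt k') else 0) / 2 := by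
    have h2 := Finset.sum_nonneg fun k (_ : k ∈ weilPrimeIndex a) ↦
      Finset.sum_nonneg fun k' (_ : k' ∈ (weilPrimeIndex a).erase k) ↦
        show 0 ≤ (if sm k k' = 0 then (Λ k : ℝ) / Real.sqrt k * ((Λ k' : ℝ) / Real.sqrt k') else 0) by
          split_ifs; exacts [mul_nonneg (hw k) (hw k'), le_rfl]
    have h3 := Finset.sum_nonneg fun k (_ : k ∈ weilPrimeIndex a) ↦
      Finset.sum_nonneg fun k' (_ : k' ∈ weilPrimeIndex a) ↦
        show 0 ≤ (if sp k k' = 0 then (Λ k : ℝ) / Real.sqrt k * ((Λ k' : ℝ) / Real.sqrt k') else 0) by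
          split_ifs; exacts [mul_nonneg (hw k) (hw k'), le_rfl]
    have h4 := add_nonneg (div_nonneg h2 (zero_le_two (α := ℝ))) (div_nonneg h3 (zero_le_two (α := ℝ)))
    exact h4
  have hcbar : 0 ≤ ((a * (1 + weilArchDensity (2 * a)) / (π * B₃)) ^ 2 + (∑ k ∈ weilPrimeIndex a, ((Λ k : ℝ) / Real.sqrt k) ^ 2) / 2 + 2 * (a * (1 + weilArchDensity (2 * a)) / (π * B₃)) * (∑ k ∈ weilPrimeIndex a, (Λ k : ℝ) / Real.sqrt k) + ((∑ k ∈ weilPrimeIndex a, ∑ k' ∈ (weilPrimeIndex a).erase k, if sm k k' = 0 then (Λ k : ℝ) / Real.sqrt k * ((Λ k' : ℝ) / Real.sqrt k') else 0) / 2 + (∑ k ∈ weilPrimeIndex a, ∑ k' ∈ weilPrimeIndex a, if sp k k' = 0 then (Λ k : ℝ) / Real.sqrt k * ((Λ k' : ℝ) / Real.sqrt k') else 0) / 2)) := by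
    have h2 := Finset.sum_nonneg fun k (_ : k ∈ weilPrimeIndex a) ↦ sq_nonneg ((Λ k : ℝ) / Real.sqrt k)
    have h3 := sq_nonneg (a * (1 + weilArchDensity (2 * a)) / (π * B₃))
    have h4 := mul_nonneg (mul_nonneg (zero_le_two (α := ℝ)) hc) hW1
    have h5 := div_nonneg h2 (zero_le_two (α := ℝ))
    have h6 := add_nonneg (add_nonneg (add_nonneg h3 h5) h4) hκ2
    exact h6
  have hmode : ∀ m ∈ T, (δm m + Sm m) ^ 2 ≤ ((a * (1 + weilArchDensity (2 * a)) / (π * B₃)) ^ 2 + (∑ k ∈ weilPrimeIndex a, ((Λ k : ℝ) / Real.sqrt k) ^ 2) / 2 + 2 * (a * (1 + weilArchDensity (2 * a)) / (π * B₃)) * (∑ k ∈ weilPrimeIndex a, (Λ k : ℝ) / Real.sqrt k) + ((∑ k ∈ weilPrimeIndex a, ∑ k' ∈ (weilPrimeIndex a).erase k, if sm k k' = 0 then (Λ k : ℝ) / Real.sqrt k * ((Λ k' : ℝ) / Real.sqrt k') else 0) / 2 + (∑ k ∈ weilPrimeIndex a, ∑ k' ∈ weilPrimeIndex a, if sp k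 k' = 0 then (Λ k : ℝ) / Real.sqrt k * ((Λ k' : ℝ) / Real.sqrt k') else 0) / 2))
      + ((∑ k ∈ weilPrimeIndex a, ∑ k' ∈ (weilPrimeIndex a).erase k, (if sm k k' = 0 then (0 : ℝ) else 1) * ((Λ k : ℝ) / Real.sqrt k * ((Λ k' : ℝ) / Real.sqrt k')) * Real.cos ((m : ℝ) * (π * Real.log k / a - π * Real.log k' / a))) / 2 - (∑ k ∈ weilPrimeIndex a, ∑ k' ∈ weilPrimeIndex a, (if sp k k' = 0 then (0 : ℝ) else 1) * ((Λ k : ℝ) / Real.sqrt k * ((Λ k' : ℝ) / Real.sqrt k')) * Real.cos ((m : ℝ) * (π * Real.log k / a + π * Real.log k' / a))) / 2) := by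
    intro m hm
    exact modeSqCentered_le (weilPrimeIndex a) (fun k ↦ (Λ k : ℝ) / Real.sqrt k) (fun k ↦ π * Real.log k / a) hw
      (m : ℝ) (δm m) hc (hδ m hm) sm sp
  -- the three Gram-entry bounds (pairs; singles on A×A; singles on A×B)
  have hρP := fun j j' : Fin DA ↦ abs_sum_Ico_oscPairs_div_pow_le (weilPrimeIndex a) (fun k ↦ (Λ k : ℝ) / Real.sqrt k)
    (fun k ↦ π * Real.log k / a) hw sm sp hsm' hsp' hB₃1 (eA j + eA j') N
  have heAA : ∀ j j' : Fin DA, 2 ≤ eA j + eA j' := fun j j' ↦ by have := heA j; have := heA j'; omega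
  have heAB : ∀ (j : Fin DA) (r' : Fin DB), 2 ≤ eA j + eB r' := fun j r' ↦ by have := heA j; have := heB r'; omega
  have hrA := fun j j' : Fin DA ↦ abs_sum_Ico_primeSum_div_pow_le (weilPrimeIndex a) (fun k ↦ (Λ k : ℝ) / Real.sqrt k)
    (fun k ↦ π * Real.log k / a) hw s₁ hs₁' hB₃ (heAA j j') N
  have hrX := fun (j : Fin DA) (r' : Fin DB) ↦ abs_sum_Ico_primeSum_div_pow_le (weilPrimeIndex a)
    (fun k ↦ (Λ k : ℝ) / Real.sqrt k) (fun k ↦ π * Real.log k / a) hw s₁ hs₁' hB₃ (heAB j r') N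
  -- the two zeta-Gram bounds
  have hQJ := sum_Ico_sq_add_sum_div_pow_le eA eB heA heB hB₃ mu nu hmu hnu N (fun j ↦ αA j / 4) αB
  have hQA := sum_Ico_sq_sum_div_pow_le eA heA hB₃ mu hmu N αA
  -- the joint bound
  have hjoint := sum_sq_joint_le T δm Sm _ hc hcbar hδ hmode eA eB αA αB mu nu hmu hnu hQJ hQA
    (fun j j' ↦ ((∑ k ∈ weilPrimeIndex a, ∑ k' ∈ (weilPrimeIndex a).erase k, (Λ k : ℝ) / Real.sqrt k * ((Λ k' : ℝ) / Real.sqrt k') / sm k k') / 2 + (∑ k ∈ weilPrimeIndex a, ∑ k' ∈ weilPrimeIndex a, (Λ k : ℝ) / Real.sqrt k * ((Λ k' : ℝ) / Real.sqrt k') / sp k k') / 2) / (B₃ : ℝ) ^ (eA j + eA j'))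
    (fun j j' ↦ ((∑ k ∈ weilPrimeIndex a, (Λ k : ℝ) / Real.sqrt k / s₁ k) / (B₃ : ℝ) ^ (eA j + eA j') + (∑ k ∈ weilPrimeIndex a, if s₁ k = 0 then (Λ k : ℝ) / Real.sqrt k else 0) * (1 / ((eA j + eA j' - 1 : ℕ) * (((B₃ - 1 : ℕ) : ℝ)) ^ (eA j + eA j' - 1)))))
    (fun j r' ↦ ((∑ k ∈ weilPrimeIndex a, (Λ k : ℝ) / Real.sqrt k / s₁ k) / (B₃ : ℝ) ^ (eA j + eB r') + (∑ k ∈ weilPrimeIndex a, if s₁ k = 0 then (Λ k : ℝ) / Real.sqrt k else 0) * (1 / ((eA j + eB r' - 1 : ℕ) * (((B₃ - 1 : ℕ) : ℝ)) ^ (eA j + eB r' - 1)))))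
    hρP (fun j j' ↦ by simp only [Nat.add_comm]) hrA (fun j j' ↦ by simp only [Nat.add_comm]) hrX
  rw [hstruct]
  refine hjoint.trans (le_of_eq ?_)
  ring

end Structured

end Summit.RiemannHypothesis.RiemannHypothesis.Theorems.WeilFormatC

end
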